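import Literature.AlgebraicGeometry.HodgeTheory.FermatEigenspaceVanishing
import Literature.AlgebraicGeometry.HodgeTheory.FermatCoordinateSectionPoints
import Literature.AlgebraicTopology.SingularHomology.ComplementRelativeHomologyDuality
import Literature.Topology.FourManifolds.ComplexProjectiveSpaceHomologyProofs
import HarnessLib

/-!
# Odd-dimensional Fermat varieties: restriction to the affine pieces is injective on `H²ᵖ⁺¹`, and `b₂ₚ₊₁(X²ᵖ⁺¹ₘ) ≤ #𝔄²ᵖ⁺¹ₘ` (Shioda 1979 §1; Ran 1980 Prop. 1.7 (i))

Family `hodge`, layer `Literature/AlgebraicGeometry/HodgeTheory`. PROOF FILE (theorems only; no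
definition, no named fact, D-0026). For the odd-dimensional Fermat variety
`X = X²ᵖ⁺¹ₘ : Σ xᵢᵐ = 0` in `ℙ²ᵖ⁺²` and a coordinate hyperplane section `Z_k = {x_k = 0} ∩ X ≅ X²ᵖₘ`
with affine complement `U_k`:

* `injective_restrictCompl_of_subsingleton` — **general mechanism (any `Xⁿ⁺¹ₘ`, degrees
  `p' + q = 2(n+1)`)**: if `H^{p'}(Xⁿₘ(ℂ); ℂ) = 0` then `H^q(Xⁿ⁺¹ₘ(ℂ); ℂ) → H^q(U_k(ℂ); ℂ)` is
  injective. Proof: `H_q(Xⁿ⁺¹ₘ(ℂ), U_k(ℂ)) ≅ H^{p'}(Z_k(ℂ)) ≅ H^{p'}(Xⁿₘ(ℂ)) = 0` (the tree's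
  Alexander–Lefschetz–Čech duality read in relative homology,
  `ComplementRelativeHomologyDuality`, along the taut closed copy `Z_k(ℂ)` of `Xⁿₘ(ℂ)`,
  `FermatCoordinateSectionPoints`), so `H_q(U_k(ℂ)) → H_q(Xⁿ⁺¹ₘ(ℂ))` is onto (long exact
  sequence of the pair) and dually the pull-back is one-to-one (Kronecker duality over `ℂ`).
  In print: the Thom–Gysin sequence `H^{q-2}(Z_k) → H^q(X) → H^q(U_k)` (Voisin II §6.1.1) with
  `H^{q-2}(Z_k) ≅ H^{p'}(Z_k)^∨ = 0` by Poincaré duality on `Z_k`;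
* `subsingleton_complexBetti_fermat_zero`, `subsingleton_complexBetti_fermat_odd` — the odd
  cohomology of an even-dimensional Fermat variety vanishes off the middle degree (Lefschetz in
  the lower range, the tree's `surjective_map_of_lt`, `Hᵒᵈᵈ(ℙᴺ(ℂ)) = 0`; Poincaré duality for the
  upper range), and `Hʲ(X⁰ₘ(ℂ)) = 0` for `j > 0` (a finite set);
* `injective_restrictCompl_fermat_odd` — **hence `H²ᵖ⁺¹(X²ᵖ⁺¹ₘ(ℂ)) → H²ᵖ⁺¹(U_k(ℂ))` is injective
  for every `k`** (Ran 1980, (1.5): the primitive = whole odd middle cohomology embeds in the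
  cohomology of the affine Fermat variety);
* `fermatEigenspace_eq_bot_odd_of_apply_eq_zero`, `fermatEigenspace_le_span_odd` — so every
  `V(β) ⊆ H²ᵖ⁺¹(X²ᵖ⁺¹ₘ(ℂ); ℂ)` is at most a line, and `V(β) = 0` unless all `βᵢ ≠ 0` (Pham /
  Milnor Thm. 9.1 on the affine piece, `FermatEigenspaceVanishing`);
* `finrank_complexBetti_fermat_odd_le` — **`b₂ₚ₊₁(X²ᵖ⁺¹ₘ) ≤ #{β ∈ (ℤ/m ∖ 0)^{2p+3} : Σ βᵢ = 0}`**,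
  the upper bound half of Shioda's `dim Hⁿ_prim(Xⁿₘ) = #𝔄ⁿₘ` in odd dimension `n`
  (character decomposition `H = ⊕ V(β)`, `isInternal_fermatEigenspace`).

## References

* [Shioda1979HodgeFermat] T. Shioda, The Hodge conjecture for Fermat varieties, Math. Ann. 245
  (1979) 175–184, §1.
* [Ran1980] Z. Ran, Cycles on Fermat hypersurfaces, Compositio Math. 42 (1980), §1 (1.5),
  Lemma 1.4, Prop. 1.7 (i).
* [VoisinHodgeII2003] C. Voisin, Hodge Theory and Complex Algebraic Geometry II (CUP 2003),
  §1.2.2 Thm. 1.23, §6.1.1.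
* [HatcherAT2002] A. Hatcher, Algebraic Topology (CUP 2002), Thm. 2.16, §3.1 Thm. 3.2, §3.3
  Prop. 3.46, Thm. 3.19.
-/

noncomputable section

open CategoryTheory AlgebraicGeometry Topology

namespace Literature.AlgebraicGeometry.HodgeTheory

open Literature.AlgebraicGeometry.Motives Literature.AlgebraicTopology.SingularHomology
open Literature.AlgebraicTopology.Homotopy

variable {n m : ℕ}

/-! ### The general mechanism: vanishing of `H^{p'}(Xⁿₘ(ℂ))` forces injectivity of restriction in degree `q`, `p' + q = 2(n+1)` -/

/-- A space homeomorphic to one with `Hᵖ = 0` has `Hᵖ = 0`. [folklore] -/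
theorem subsingleton_singularCohomology_of_homeomorph {A B : Type} [TopologicalSpace A]
    [TopologicalSpace B] (e : A ≃ₜ B) (p : ℕ) [Subsingleton (singularCohomology ℂ ℂ A p)] :
    Subsingleton (singularCohomology ℂ ℂ B p) :=
  (singularCohomology.mapIso ℂ ℂ e p).toLinearEquiv.toEquiv.subsingleton

/-- **If `H^{p'}(Xⁿₘ(ℂ); ℂ) = 0` and `p' + q = 2(n + 1)`, then the restriction
`H^q(Xⁿ⁺¹ₘ(ℂ); ℂ) → H^q(U_k(ℂ); ℂ)` to the affine piece `U_k = Xⁿ⁺¹ₘ ∖ Z_k` is injective**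
(`m ≥ 1`): by Alexander–Lefschetz–Čech duality in the closed oriented `2(n+1)`-manifold
`Xⁿ⁺¹ₘ(ℂ)` along the taut closed subset `Z_k(ℂ) ≅ Xⁿₘ(ℂ)`,
`H_q(Xⁿ⁺¹ₘ(ℂ), U_k(ℂ)) ≅ H^{p'}(Z_k(ℂ)) = 0`, so `H_q(U_k(ℂ)) → H_q(Xⁿ⁺¹ₘ(ℂ))` is onto and the
pull-back is one-to-one over the field `ℂ`. [cite: VoisinHodgeII2003, §6.1.1 (Thom–Gysin sequence)]
[cite: HatcherAT2002, Thm. 2.16, §3.1 Thm. 3.2 and §3.3 Prop. 3.46] -/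
theorem injective_restrictCompl_of_subsingleton (hm : 1 ≤ m) (k : Fin (n + 3)) {p' q : ℕ}
    (h : p' + q = 2 * (n + 1)) [Subsingleton (complexBetti (fermatHypersurface n m) p')] :
    Function.Injective (complexBetti.restrictCompl (fermatHypersurface (n + 1) m)
      (fermatCoordHyperplane (n + 1) m k) q) := by
  have hX : IsSmoothProjective (n + 1) (fermatHypersurface (n + 1) m) :=
    isSmoothProjective_fermatHypersurface (by omega) hm
  letI := hX.chartedSpace
  haveI := ComplexPoints.compactSpace_of_isSmoothProjective hX
  haveI := ComplexPoints.t2Space_of_isSmoothProjective hX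
  obtain ⟨μ⟩ := ComplexPoints.isOrientableOver ℂ hX
  set K : Set (ComplexPoints (fermatHypersurface (n + 1) m)) :=
    {P | P.pt ∈ fermatCoordHyperplane (n + 1) m k} with hKdef
  have hK : IsClosed K := isClosed_fermatSectionPoints (Nat.one_le_iff_ne_zero.mp hm) k
  obtain ⟨T⟩ := nonempty_retractionNhds_fermatSectionPoints (n := n) hm k
  obtain ⟨eK⟩ := nonempty_homeomorph_fermatSectionPoints (n := n) (Nat.one_le_iff_ne_zero.mp hm) k
  -- `H_q(X(ℂ), U_k(ℂ)) ≅ H^{p'}(Z_k(ℂ)) ≅ H^{p'}(Xⁿₘ(ℂ)) = 0`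
  obtain ⟨eD⟩ :=
    relativeSingularHomology.nonempty_linearEquiv_singularCohomology_of_retractionNhds μ hK T h
  haveI : Subsingleton (singularCohomology ℂ ℂ (↥K) p') :=
    subsingleton_singularCohomology_of_homeomorph eK p'
  haveI : Subsingleton (relativeSingularHomology ℂ ℂ (ComplexPoints (fermatHypersurface (n + 1) m)) Kᶜ q) :=
    eD.toEquiv.subsingleton
  have hz : Limits.IsZero
      (relativeSingularHomology ℂ ℂ (ComplexPoints (fermatHypersurface (n + 1) m)) Kᶜ q) :=
    ModuleCat.isZero_of_subsingleton _
  exact singularCohomology.map_injective_of_map_surjective ℂ _ q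
    (relativeSingularHomology.map_surjective_of_isZero Kᶜ q hz)

/-! ### Odd cohomology of even-dimensional Fermat varieties, and `H⁰`-only for `X⁰ₘ` -/

/-- **`Hʲ(X⁰ₘ(ℂ); ℂ) = 0` for `j ≠ 0`** (`X⁰ₘ(ℂ)` is a finite discrete set).
[cite: HatcherAT2002, Prop. 2.6 and Prop. 2.8] -/
theorem subsingleton_complexBetti_fermat_zero (hm : 1 ≤ m) {j : ℕ} (hj : j ≠ 0) :
    Subsingleton (complexBetti (fermatHypersurface 0 m) j) := by
  haveI := finite_complexPoints_fermat_zero hm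
  obtain ⟨e⟩ := nonempty_homeomorph_fermatSectionPoints (n := 0) (Nat.one_le_iff_ne_zero.mp hm) 0
  haveI : T2Space (ComplexPoints (fermatHypersurface 0 m)) := by
    haveI := ComplexPoints.t2Space_of_isSmoothProjective
      (isSmoothProjective_fermatHypersurface (n := 0 + 1) le_rfl hm)
    exact e.symm.t2Space
  haveI : DiscreteTopology (ComplexPoints (fermatHypersurface 0 m)) := inferInstance
  have hz := isZero_singularHomology_of_totallyDisconnectedSpace ℂ ℂ
    (X := ComplexPoints (fermatHypersurface 0 m)) hj
  haveI := ModuleCat.subsingleton_of_isZero hz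
  exact (kroneckerPairing_injective_of_field ℂ (ComplexPoints (fermatHypersurface 0 m)) j).subsingleton

/-- `Hʲ(ℙᴺ(ℂ); ℂ) = 0` for `j` odd (`Hⱼ(ℂℙᴺ) = 0`, Hatcher Thm. 2.35 (iii), and universal
coefficients over a field). [cite: HatcherAT2002, Thm. 3.19 and §3.1 Thm. 3.2] -/
theorem subsingleton_complexBetti_projectiveSpace_of_odd (N : ℕ) {j : ℕ} (hj : Odd j) :
    Subsingleton (complexBetti (projectiveSpace N ℂ) j) := by
  have hz := (Literature.Topology.FourManifolds.singularHomology_complexProjectiveSpace_of_module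
    ℂ ℂ N j).2 (fun h ↦ (Nat.not_even_iff_odd.mpr hj) h.1)
  haveI := ModuleCat.subsingleton_of_isZero hz
  haveI : Subsingleton (singularCohomology ℂ ℂ
      (Literature.Topology.FourManifolds.ComplexProjectiveSpace N) j) :=
    (kroneckerPairing_injective_of_field ℂ
      (Literature.Topology.FourManifolds.ComplexProjectiveSpace N) j).subsingleton
  exact (singularCohomology.mapIso ℂ ℂ
    (complexPointsProjectiveSpaceHomeomorph N) j).toLinearEquiv.toEquiv.symm.subsingleton

/-- **Odd cohomology below the middle vanishes**: `Hʲ(Xⁿₘ(ℂ); ℂ) = 0` for `j` odd, `j < n`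
(`n, m ≥ 1`): Lefschetz surjectivity `Hʲ(ℙⁿ⁺¹(ℂ)) ↠ Hʲ(Xⁿₘ(ℂ))` (Voisin II Thm. 1.23, the
tree's `surjective_map_of_lt`) from a zero group. [cite: VoisinHodgeII2003, §1.2.2 Thm. 1.23] -/
theorem subsingleton_complexBetti_fermat_of_odd_lt (hn : 1 ≤ n) (hm : 1 ≤ m) {j : ℕ} (hj : Odd j)
    (hjn : j < n) : Subsingleton (complexBetti (fermatHypersurface n m) j) := by
  have hY := isSmoothHypersurface_fermatHypersurface hn hm
  obtain ⟨F, hFhom, hFirr, _, ι, hι, hrange⟩ := hY.2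
  haveI := hι
  haveI := subsingleton_complexBetti_projectiveSpace_of_odd (n + 1) hj
  exact (surjective_map_of_lt hY hFhom hFirr ι hrange hjn).subsingleton

/-- **Odd cohomology above the middle vanishes**: `Hʲ(Xⁿₘ(ℂ); ℂ) = 0` for `j` odd, `n < j`
(`n, m ≥ 1`): Poincaré duality `bⱼ = b_{2n-j}` on the closed oriented manifold `Xⁿₘ(ℂ)` and the
lower range (for `j > 2n` the group vanishes for dimension reasons). [cite: VoisinHodgeII2003, §1.2.3 Cor. 1.25]
[cite: HatcherAT2002, §3.3 Cor. 3.37] -/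
theorem subsingleton_complexBetti_fermat_of_odd_gt (hn : 1 ≤ n) (hm : 1 ≤ m) {j : ℕ} (hj : Odd j)
    (hnj : n < j) : Subsingleton (complexBetti (fermatHypersurface n m) j) := by
  have hX : IsSmoothProjective n (fermatHypersurface n m) := isSmoothProjective_fermatHypersurface hn hm
  by_cases hj2 : 2 * n < j
  · exact subsingleton_complexBetti hX hj2
  · haveI := finite_complexBetti hX j
    have hlt : Subsingleton (complexBetti (fermatHypersurface n m) (2 * n - j)) := by
      refine subsingleton_complexBetti_fermat_of_odd_lt hn hm ?_ (by omega)
      obtain ⟨t, rfl⟩ := hj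
      exact ⟨n - t - 1, by omega⟩
    have h0 : Module.finrank ℂ (complexBetti (fermatHypersurface n m) j) = 0 := by
      rw [ComplexPoints.finrank_singularCohomology_eq_of_add_eq ℂ hX (p := j) (q := 2 * n - j) (by omega)]
      exact Module.finrank_zero_of_subsingleton
    exact Module.finrank_zero_iff.mp h0

/-! ### The odd-dimensional Fermat variety -/

/-- **Restriction to every affine piece is injective on the odd middle cohomology**:
`H²ᵖ⁺¹(X²ᵖ⁺¹ₘ(ℂ); ℂ) → H²ᵖ⁺¹(U_k(ℂ); ℂ)` is one-to-one (`m ≥ 1`, any `p`, any coordinate `k`) —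
`H²ᵖ⁺¹(X²ᵖₘ(ℂ)) = 0` (odd above the middle; for `p = 0`, `X⁰ₘ(ℂ)` is finite) feeds
`injective_restrictCompl_of_subsingleton`. This is Ran's (1.5) in odd dimension: the whole of
`H²ᵖ⁺¹(X)` is primitive and embeds in the cohomology of the affine Fermat variety.
[cite: Ran1980, §1 (1.5) and Lemma 1.4] [cite: VoisinHodgeII2003, §6.1.1] -/
theorem injective_restrictCompl_fermat_odd (hm : 1 ≤ m) (p : ℕ) (k : Fin (2 * p + 3)) :
    Function.Injective (complexBetti.restrictCompl (fermatHypersurface (2 * p + 1) m)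
      (fermatCoordHyperplane (2 * p + 1) m k) (2 * p + 1)) := by
  rcases Nat.eq_zero_or_pos p with rfl | hp
  · haveI := subsingleton_complexBetti_fermat_zero hm (j := 1) one_ne_zero
    exact injective_restrictCompl_of_subsingleton (n := 0) hm k (p' := 1) (q := 1) rfl
  · haveI := subsingleton_complexBetti_fermat_of_odd_gt (n := 2 * p) (by omega) hm (j := 2 * p + 1)
      ⟨p, rfl⟩ (by omega)
    exact injective_restrictCompl_of_subsingleton (n := 2 * p) hm k (p' := 2 * p + 1)
      (q := 2 * p + 1) (by ring)

/-- **`V(β) = 0` in `H²ᵖ⁺¹(X²ᵖ⁺¹ₘ(ℂ); ℂ)` whenever some `βᵢ = 0`** (`m ≥ 1`; including `β = 0`):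
injectivity of restriction to a chart `U_k`, `k ≠ i`, on all of `H²ᵖ⁺¹`, and the vanishing of the
covariant functionals of a character trivial on one factor of the torus of the affine piece
(`fermatEigenspace_eq_bot_of_injOn`). [cite: Shioda1979HodgeFermat, §1] [cite: Ran1980, §1 Prop. 1.7 (i)] -/
theorem fermatEigenspace_eq_bot_odd_of_apply_eq_zero (hm : 1 ≤ m) (p : ℕ)
    {β : Fin (2 * p + 3) → ZMod m} {i : Fin (2 * p + 3)} (hi : β i = 0) :
    fermatEigenspace m β (2 * p + 1) = ⊥ := by
  obtain ⟨k, hk⟩ := exists_ne i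
  obtain ⟨j, hj⟩ := Fin.exists_succAbove_eq hk.symm
  exact fermatEigenspace_eq_bot_of_injOn (N := 2 * p + 1) (by omega) (by omega) k
    ((injective_restrictCompl_fermat_odd hm p k).injOn) j (by rw [hj]; exact hi)

/-- **Every `V(β) ⊆ H²ᵖ⁺¹(X²ᵖ⁺¹ₘ(ℂ); ℂ)` is at most a line** (`m ≥ 1`): multiplicity one of the
torus characters on the homology of the affine piece (`fermatEigenspace_le_span_of_injOn`).
[cite: Ran1980, §1 Prop. 1.7 (i)] -/
theorem fermatEigenspace_le_span_odd (hm : 1 ≤ m) (p : ℕ) (β : Fin (2 * p + 3) → ZMod m) :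
    ∃ v, fermatEigenspace m β (2 * p + 1) ≤ ℂ ∙ v :=
  fermatEigenspace_le_span_of_injOn (N := 2 * p + 1) (by omega) (by omega) 0
    ((injective_restrictCompl_fermat_odd hm p 0).injOn)

/-- **`b₂ₚ₊₁(X²ᵖ⁺¹ₘ) ≤ #{β ∈ (ℤ/m)^{2p+3} : all βᵢ ≠ 0, Σ βᵢ = 0}`** (`m ≥ 1`): the character
decomposition `H²ᵖ⁺¹(X²ᵖ⁺¹ₘ(ℂ); ℂ) = ⊕_β V(β)` (`iSup_fermatEigenspace_eq_top`), each `V(β)` at most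
a line (`fermatEigenspace_le_span_odd`), `V(β) = 0` when `Σ βᵢ ≠ 0`
(`fermatEigenspace_eq_bot_of_sum_ne_zero`) or some `βᵢ = 0`
(`fermatEigenspace_eq_bot_odd_of_apply_eq_zero`). The upper-bound half of Shioda's
"`dim Hⁿ_prim(Xⁿₘ) = |𝔄ⁿₘ|`" for odd `n`. [cite: Shioda1979HodgeFermat, §1] [cite: Ran1980, §1 Prop. 1.7 (i)] -/
theorem finrank_complexBetti_fermat_odd_le [NeZero m] (p : ℕ) :
    Module.finrank ℂ (complexBetti (fermatHypersurface (2 * p + 1) m) (2 * p + 1)) ≤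
      Fintype.card {β : Fin (2 * p + 3) → ZMod m // (∀ i, β i ≠ 0) ∧ ∑ i, β i = 0} := by
  classical
  have hm : 1 ≤ m := NeZero.one_le
  have hX : IsSmoothProjective (2 * p + 1) (fermatHypersurface (2 * p + 1) m) :=
    isSmoothProjective_fermatHypersurface (by omega) hm
  haveI := finite_complexBetti hX (2 * p + 1)
  -- spanning vectors of the lines `V(β)`
  have hv : ∀ β : Fin (2 * p + 3) → ZMod m, ∃ v, fermatEigenspace m β (2 * p + 1) ≤ ℂ ∙ v :=
    fun β ↦ fermatEigenspace_le_span_odd hm p β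
  choose v hv using hv
  set b : {β : Fin (2 * p + 3) → ZMod m // (∀ i, β i ≠ 0) ∧ ∑ i, β i = 0} →
      complexBetti (fermatHypersurface (2 * p + 1) m) (2 * p + 1) := fun s ↦ v s.1 with hb
  -- `⊤ = ⨆ V(β) ≤ span (range b)`
  have htop : (⊤ : Submodule ℂ (complexBetti (fermatHypersurface (2 * p + 1) m) (2 * p + 1))) ≤
      Submodule.span ℂ (Set.range b) := by
    rw [← iSup_fermatEigenspace_eq_top (n := 2 * p + 1) (m := m) (2 * p + 1)]
    refine iSup_le fun β ↦ ?_
    by_cases hgood : (∀ i, β i ≠ 0) ∧ ∑ i, β i = 0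
    · exact (hv β).trans (Submodule.span_mono (Set.singleton_subset_iff.mpr ⟨⟨β, hgood⟩, rfl⟩))
    · have hbot : fermatEigenspace m β (2 * p + 1) = ⊥ := by
        rw [not_and_or] at hgood
        rcases hgood with h1 | h2
        · push Not at h1
          obtain ⟨i, hi⟩ := h1
          exact fermatEigenspace_eq_bot_odd_of_apply_eq_zero hm p hi
        · exact fermatEigenspace_eq_bot_of_sum_ne_zero h2 _
      rw [hbot]
      exact bot_le
  calc Module.finrank ℂ (complexBetti (fermatHypersurface (2 * p + 1) m) (2 * p + 1))
      = Module.finrank ℂ (⊤ : Submodule ℂ (complexBetti (fermatHypersurface (2 * p + 1) m) (2 * p + 1))) :=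
        (finrank_top ℂ _).symm
    _ ≤ Module.finrank ℂ (Submodule.span ℂ (Set.range b)) := Submodule.finrank_mono htop
    _ ≤ Fintype.card {β : Fin (2 * p + 3) → ZMod m // (∀ i, β i ≠ 0) ∧ ∑ i, β i = 0} :=
        finrank_range_le_card b

end Literature.AlgebraicGeometry.HodgeTheory

end
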